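import Summits.Ventures.PercRepro.C025ProfileThinRowE

/-!
# THE ROW `(q, q+1)` IN THE THIN REGIME FOR EVERY `q`: THE SIZE CONDITION `(g − 1)(n − q − 1) ≥ g (q + 2 − g)` (night-3 g14)
`proofs/NIGHT3-G14-SIZE.md`. THEOREM T(q ≤ 5) and THEOREM T(q, g) (parts C and E) bound the load of a rank-`(q+1)` set `S` with
`q + 2` points by `c + c (q + 2 − c)/(m + 1)` with `c = #col S` coloops and `m = |E ∖ S|`, and then use only `m + 1 ≥ q + 1`. Writing
`k := q + 2 − c ≥ g` for the size of the unique circuit of `S`, the exact requirement is `k (q + 2 − k) ≤ (k − 1)(m + 1)`, and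
`f(k) = k (q + 2 − k)/(k − 1)` is DECREASING in `k` (`arith_size_key`: `(g+d−1) g (c+d) − (g−1) c (g+d) = d (c + g (g + d − 1))`), so the
smallest circuit size `g` binds: with `m + 1 = n − q − 1` (`n = |E|`) the rule is a certificate whenever
    `g (q + 2 − g) ≤ (g − 1)(n − q − 1)`            (g = 3: `2n ≥ 5q − 1`).
Hence **THEOREM T(q, g, n)** `profileIneq_succ_of_thin_size` / `hallIneq_succ_of_thin_size`: the row `(q, q+1)` of C-032 and its Hall form
(C-033) for EVERY `q`, for every finite matroid of girth `≥ g ≥ 3` in which every rank-`q` set has at most `q + 1` points, whenever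
`(g − 1)(n − q − 1) ≥ g (q + 2 − g)`; `profileIneq_succ_of_thin_card`: simple + thin + `5q ≤ 2n + 1`. T(q ≤ 5) and T(q, g) are the
cases in which `n − q − 1 ≥ q + 1` (forced by a demanding set) already gives the size condition. The bound is exact for this rule:
the paper's `M_q` (n = 2q + 2, g = 3) violates (Cap) for every `q ≥ 6`, and `2(2q+2) < 5q − 1` exactly when `q ≥ 6`.
-/
open scoped Matroid
namespace PercRepro
open Set Finset ThmH Staged
namespace ThinRow
variable {α : Type} [DecidableEq α] {M : Matroid α} [M.Finite]

/-- **The capacity arithmetic with the size condition**: for `c + g ≤ q + 2`, `g ≥ 1` and `g (q + 2 − g) ≤ (g − 1)(m + 1)`,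
`c (m + 1) + c (q + 2 − c) ≤ (q + 1)(m + 1)` — i.e. `f(k) = k (q + 2 − k)/(k − 1)` is decreasing in the circuit size `k = q + 2 − c ≥ g`. -/
theorem arith_size_key {q c g m : ℕ} (hg1 : 1 ≤ g) (hc : c + g ≤ q + 2)
    (hsize : g * (q + 2 - g) ≤ (g - 1) * (m + 1)) :
    c * (m + 1) + c * (q + 2 - c) ≤ (q + 1) * (m + 1) := by
  obtain ⟨d, hd⟩ : ∃ d, c + g + d = q + 2 := ⟨q + 2 - (c + g), by omega⟩
  obtain ⟨g', rfl⟩ : ∃ g', g = g' + 1 := ⟨g - 1, by omega⟩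
  have h1 : q + 2 - c = g' + 1 + d := by omega
  have h2 : q + 2 - (g' + 1) = c + d := by omega
  have h3 : g' + 1 - 1 = g' := by omega
  have h4 : q + 1 = c + g' + d := by omega
  rw [h1, h4]
  rw [h2, h3] at hsize
  suffices h : c * (g' + 1 + d) ≤ (g' + d) * (m + 1) by nlinarith
  rcases Nat.eq_zero_or_pos g' with hg0 | hgpos
  · subst hg0
    have hcd : c + d = 0 := by
      have : (0 + 1) * (c + d) ≤ 0 * (m + 1) := hsize
      omega
    have hc0 : c = 0 := by omega
    have hd0 : d = 0 := by omega
    subst hc0; subst hd0; simp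
  · have key : g' * (c * (g' + 1 + d)) ≤ g' * ((g' + d) * (m + 1)) := by
      calc g' * (c * (g' + 1 + d)) ≤ (g' + d) * ((g' + 1) * (c + d)) := by
            have hid : (g' + d) * ((g' + 1) * (c + d)) =
                g' * (c * (g' + 1 + d)) + d * (c + (g' + 1) * (g' + d)) := by ring
            rw [hid]; exact Nat.le_add_right _ _
        _ ≤ (g' + d) * (g' * (m + 1)) := Nat.mul_le_mul_left _ hsize
        _ = g' * ((g' + d) * (m + 1)) := by ring
    exact Nat.le_of_mul_le_mul_left key hgpos

/-- The thin-regime arithmetic with the size condition: `a + b/(m+1) ≤ q + 1` when `a ≤ c`, `b ≤ c (q + 2 − c)`, `c + g ≤ q + 2` and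
`g (q + 2 − g) ≤ (g − 1)(m + 1)` (no lower bound on `m` is needed any more). -/
theorem arith_thin_size {q c a b m g : ℕ} (hg1 : 1 ≤ g) (hc : c + g ≤ q + 2) (ha : a ≤ c)
    (hb : b ≤ c * (q + 2 - c)) (hsize : g * (q + 2 - g) ≤ (g - 1) * (m + 1)) :
    (a : ℚ) + (b : ℚ) / ((m : ℚ) + 1) ≤ (q : ℚ) + 1 := by
  have hm : (0 : ℚ) < (m : ℚ) + 1 := by positivity
  have key := arith_size_key hg1 hc hsize
  have hcq : c ≤ q + 2 := by omega
  have hcast : ((q + 2 - c : ℕ) : ℚ) = (q : ℚ) + 2 - c := by rw [Nat.cast_sub hcq]; push_cast; ring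
  have key' : (c : ℚ) * ((m : ℚ) + 1) + (c : ℚ) * ((q : ℚ) + 2 - c) ≤ ((q : ℚ) + 1) * ((m : ℚ) + 1) := by
    have : ((c * (m + 1) + c * (q + 2 - c) : ℕ) : ℚ) ≤ (((q + 1) * (m + 1) : ℕ) : ℚ) := by exact_mod_cast key
    rw [Nat.cast_add, Nat.cast_mul, Nat.cast_mul, hcast] at this
    push_cast at this
    linarith
  have h2 : (b : ℚ) ≤ (c : ℚ) * ((q : ℚ) + 2 - c) := by
    have : (b : ℚ) ≤ ((c * (q + 2 - c) : ℕ) : ℚ) := by exact_mod_cast hb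
    rw [Nat.cast_mul, hcast] at this
    exact this
  have h3 : (a : ℚ) ≤ c := by exact_mod_cast ha
  have hb' : (b : ℚ) / ((m : ℚ) + 1) ≤ ((c : ℚ) * ((q : ℚ) + 2 - c)) / ((m : ℚ) + 1) :=
    div_le_div_of_nonneg_right h2 hm.le
  have hc' : (c : ℚ) * ((q : ℚ) + 2 - c) / ((m : ℚ) + 1) ≤ (q : ℚ) + 1 - c := by
    rw [div_le_iff₀ hm]; linarith
  linarith

/-- **(Cap) with the size condition**: for `g ≥ 3` and `g (q + 2 − g) ≤ (g − 1)(|E| − q − 1)`, every rank-`(q+1)` set of a thin matroid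
of girth `≥ g` carries load `≤ 1` under the simple rule (the certificate of parts A–C). -/
theorem cap_thin_size (q g : ℕ) (hg3 : 3 ≤ g) (hsize : g * (q + 2 - g) ≤ (g - 1) * ((gr M).card - q - 1))
    (hgirth : ∀ T ⊆ M.E, T.encard < g → M.Indep T)
    (hthin : ∀ X ⊆ gr M, rkN M X = q → X.card ≤ q + 1) {S : Finset α} (hS : S ∈ Shadow.levelSet M (q + 1)) :
    ∑ B ∈ (Profile.Rq M q).filter (fun B => B ⊆ S),
      ((if q + 1 ≤ crk M B ∧ ∃ x ∈ outer M B, S = insert x B then (1 : ℚ) else 0) +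
        (if q + 1 ≤ crk M B ∧ crk M B = (outer M B).card + 1 ∧ ∃ x ∈ outer M B, S = insert x (clF M B) then
          1 / ((outer M B).card : ℚ) else 0)) / ((q : ℚ) + 1) ≤ 1 := by
  rw [← Finset.sum_div, div_le_one (by positivity), Finset.sum_add_distrib]
  have h1 := sum_w1_le_card_D1 (M := M) q (S := S)
  have h2 := sum_w2_le_card_D2 q hthin hS
  set D1 := S.filter (fun x => S.erase x ∈ Profile.Rq M q ∧ q + 1 ≤ crk M (S.erase x) ∧ x ∈ outer M (S.erase x))
    with hD1
  set D2 := (S ×ˢ S).filter (fun xy => xy.1 ≠ xy.2 ∧ (S.erase xy.1).erase xy.2 ∈ Profile.Rq M q ∧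
      q + 1 ≤ crk M ((S.erase xy.1).erase xy.2) ∧
      crk M ((S.erase xy.1).erase xy.2) = (outer M ((S.erase xy.1).erase xy.2)).card + 1 ∧
      xy.1 ∈ outer M ((S.erase xy.1).erase xy.2) ∧ S = insert xy.1 (clF M ((S.erase xy.1).erase xy.2))) with hD2
  set col := S.filter (fun x => rkN M (S.erase x) + 1 = rkN M S) with hcol
  set m := (gr M \ S).card with hm
  have hD1col : D1 ⊆ col := D1_subset_col hS
  have hD2sub : D2 ⊆ col ×ˢ (S \ col) := by
    intro xy hxy
    have hf := mem_D2_facts hthin hS hxy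
    have hxy' := Finset.mem_product.mp (Finset.mem_filter.mp hxy).1
    rw [Finset.mem_product, Finset.mem_sdiff]
    exact ⟨Finset.mem_filter.mpr ⟨hxy'.1, hf.2.2.2.2.1⟩, hxy'.2,
      fun h => hf.2.2.2.2.2 (Finset.mem_filter.mp h).2⟩
  have hSq : rkN M S = q + 1 := rkN_eq_iff.mpr (Profile.mem_levelSet.mp hS).2
  have hScard_ge : q + 1 ≤ S.card := hSq ▸ rkN_le_card S
  have hSg : S ⊆ gr M := (Profile.mem_levelSet.mp hS).1
  have key : (D1.card : ℚ) + (D2.card : ℚ) / ((m : ℚ) + 1) ≤ (q : ℚ) + 1 := by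
    rcases Nat.lt_or_ge S.card (q + 2) with hlt | hge
    · have hD2e : D2 = ∅ := by
        rw [Finset.eq_empty_iff_forall_notMem]
        intro xy hxy
        have := (mem_D2_facts hthin hS hxy).2.2.1
        omega
      have hD1c : D1.card ≤ q + 1 := (Finset.card_le_card (Finset.filter_subset _ _)).trans (by omega)
      rw [hD2e, Finset.card_empty, Nat.cast_zero, zero_div, add_zero]
      exact_mod_cast hD1c
    rcases Nat.lt_or_ge S.card (q + 3) with hlt2 | hge2
    · have hScard : S.card = q + 2 := by omega
      have hc := card_col_add_girth_le hgirth hS hScard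
      rw [hScard] at hc
      have ha : D1.card ≤ col.card := Finset.card_le_card hD1col
      have hb : D2.card ≤ col.card * (q + 2 - col.card) := by
        have := Finset.card_le_card hD2sub
        rw [Finset.card_product, Finset.card_sdiff_of_subset (Finset.filter_subset _ _), hScard] at this
        exact this
      -- `m + 1 = |E| − q − 1`: the size condition transfers to `m`
      have hmE : (gr M \ S).card = (gr M).card - S.card := Finset.card_sdiff_of_subset hSg
      have hnS : S.card ≤ (gr M).card := Finset.card_le_card hSg
      have hsize' : g * (q + 2 - g) ≤ (g - 1) * (m + 1) := by
        have hm1 : m + 1 = (gr M).card - q - 1 := by rw [hm, hmE, hScard]; omega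
        rw [hm1]; exact hsize
      exact arith_thin_size (by omega : 1 ≤ g) hc ha hb hsize'
    · have hD1e : D1 = ∅ := by
        rw [Finset.eq_empty_iff_forall_notMem]
        intro x hx
        have := (card_of_mem_D1 hthin hS hx).1
        omega
      have hD2e : D2 = ∅ := by
        rw [Finset.eq_empty_iff_forall_notMem]
        intro xy hxy
        have := (mem_D2_facts hthin hS hxy).2.2.1
        omega
      rw [hD1e, hD2e, Finset.card_empty, Finset.card_empty, Nat.cast_zero, zero_div, add_zero]
      positivity
  linarith

/-- **THEOREM T(q, g, n)**: the row `(q, q+1)` of (Π) for EVERY `q`, for every finite matroid of girth `≥ g ≥ 3` whose rank-`q` sets have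
at most `q + 1` points, whenever `g (q + 2 − g) ≤ (g − 1)(|E| − q − 1)` — the exact boundary of the simple rule (`g = 3`: `2|E| ≥ 5q − 1`). -/
theorem profileIneq_succ_of_thin_size (q g : ℕ) (hg3 : 3 ≤ g)
    (hsize : g * (q + 2 - g) ≤ (g - 1) * ((gr M).card - q - 1))
    (hgirth : ∀ T ⊆ M.E, T.encard < g → M.Indep T)
    (hthin : ∀ X ⊆ gr M, rkN M X = q → X.card ≤ q + 1) : Profile.ProfileIneq M q (q + 1) :=
  profileIneq_of_cert q (q + 1)
    (fun B S => ((if q + 1 ≤ crk M B ∧ ∃ x ∈ outer M B, S = insert x B then (1 : ℚ) else 0) +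
        (if q + 1 ≤ crk M B ∧ crk M B = (outer M B).card + 1 ∧ ∃ x ∈ outer M B, S = insert x (clF M B) then
          1 / ((outer M B).card : ℚ) else 0)) / ((q : ℚ) + 1))
    (fun _ hS => cap_thin_size q g hg3 hsize hgirth hthin hS) (fun _ hB => dem_thin q hthin hB)

/-- **THEOREM T(q, g, n), Hall form (C-033).** -/
theorem hallIneq_succ_of_thin_size (q g : ℕ) (hg3 : 3 ≤ g)
    (hsize : g * (q + 2 - g) ≤ (g - 1) * ((gr M).card - q - 1))
    (hgirth : ∀ T ⊆ M.E, T.encard < g → M.Indep T)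
    (hthin : ∀ X ⊆ gr M, rkN M X = q → X.card ≤ q + 1) : Profile.HallIneq M q (q + 1) :=
  hallIneq_of_cert q (q + 1)
    (fun B S => ((if q + 1 ≤ crk M B ∧ ∃ x ∈ outer M B, S = insert x B then (1 : ℚ) else 0) +
        (if q + 1 ≤ crk M B ∧ crk M B = (outer M B).card + 1 ∧ ∃ x ∈ outer M B, S = insert x (clF M B) then
          1 / ((outer M B).card : ℚ) else 0)) / ((q : ℚ) + 1))
    (fun B S => wThin_nonneg q B S) (fun _ hS => cap_thin_size q g hg3 hsize hgirth hthin hS)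
    (fun _ hB => dem_thin q hthin hB)

omit [DecidableEq α] [M.Finite] in
/-- Simplicity is girth `≥ 3` (the conversion of the hypothesis, as in part E). -/
theorem girth_three_of_simple (hsimple : ∀ T ⊆ M.E, T.encard ≤ 2 → M.Indep T) :
    ∀ T ⊆ M.E, T.encard < ((3 : ℕ) : ℕ∞) → M.Indep T :=
  fun T hT h => hsimple T hT ((ENat.lt_add_one_iff (by norm_num)).mp (by norm_num at h ⊢; exact h))

/-- **THEOREM T(q, n)** (the case `g = 3`): the row `(q, q+1)` for every SIMPLE finite matroid in which every rank-`q` set has at most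
`q + 1` points, whenever `5q ≤ 2|E| + 1` (`q = 6`: `|E| ≥ 15`; `q = 7`: `|E| ≥ 17`; `q = 8`: `|E| ≥ 20`). -/
theorem profileIneq_succ_of_thin_card (q : ℕ) (hn : 5 * q ≤ 2 * (gr M).card + 1)
    (hsimple : ∀ T ⊆ M.E, T.encard ≤ 2 → M.Indep T)
    (hthin : ∀ X ⊆ gr M, rkN M X = q → X.card ≤ q + 1) : Profile.ProfileIneq M q (q + 1) :=
  profileIneq_succ_of_thin_size q 3 le_rfl (by omega) (girth_three_of_simple hsimple) hthin

/-- **THEOREM T(q, n), Hall form.** -/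
theorem hallIneq_succ_of_thin_card (q : ℕ) (hn : 5 * q ≤ 2 * (gr M).card + 1)
    (hsimple : ∀ T ⊆ M.E, T.encard ≤ 2 → M.Indep T)
    (hthin : ∀ X ⊆ gr M, rkN M X = q → X.card ≤ q + 1) : Profile.HallIneq M q (q + 1) :=
  hallIneq_succ_of_thin_size q 3 le_rfl (by omega) (girth_three_of_simple hsimple) hthin

/-- The first row beyond T(q ≤ 5): `(6, 7)` for every simple thin matroid on `≥ 15` points (the paper's `M₆` has 14). -/
theorem profileIneq_six_seven_of_thin_card (hn : 15 ≤ (gr M).card)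
    (hsimple : ∀ T ⊆ M.E, T.encard ≤ 2 → M.Indep T)
    (hthin : ∀ X ⊆ gr M, rkN M X = 6 → X.card ≤ 7) : Profile.ProfileIneq M 6 7 :=
  profileIneq_succ_of_thin_card 6 (by omega) hsimple hthin

/-- `(6, 7)`, Hall form, on `≥ 15` points. -/
theorem hallIneq_six_seven_of_thin_card (hn : 15 ≤ (gr M).card)
    (hsimple : ∀ T ⊆ M.E, T.encard ≤ 2 → M.Indep T)
    (hthin : ∀ X ⊆ gr M, rkN M X = 6 → X.card ≤ 7) : Profile.HallIneq M 6 7 :=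
  hallIneq_succ_of_thin_card 6 (by omega) hsimple hthin

/-- Girth `≥ 4` (no 3-circuits): the row `(q, q+1)` on thin matroids whenever `4 (q − 2) ≤ 3 (|E| − q − 1)`, i.e. `7q + 3 ≤ 3|E| + 8`
(`q = 12`: `|E| ≥ 27`, one beyond T(q, g)'s `q ≤ 11`). -/
theorem profileIneq_succ_of_thin_girth_four (q : ℕ) (hn : 4 * (q + 2 - 4) ≤ 3 * ((gr M).card - q - 1))
    (hgirth : ∀ T ⊆ M.E, T.encard < ((4 : ℕ) : ℕ∞) → M.Indep T)
    (hthin : ∀ X ⊆ gr M, rkN M X = q → X.card ≤ q + 1) : Profile.ProfileIneq M q (q + 1) :=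
  profileIneq_succ_of_thin_size q 4 (by norm_num) (by omega) hgirth hthin

end ThinRow
end PercRepro
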